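import Summits.HodgeConjecture.HodgeConjecture.Theorems.H413E2SWIdentityCloseTriplesCM   -- ★ p811251 (A-p08 (g18)): `b ≠ 0` producers' environment
import Summits.HodgeConjecture.HodgeConjecture.Theorems.H413E2SWSplitPlaceLettersOfFrame   -- ★ (B-p02 (g19)): `exists_splitPlaceLetters_of_frame`
import Summits.HodgeConjecture.HodgeConjecture.Theorems.H413E2SWSplitPlaceFrameTorus   -- ★ p811655 (A-p01 (g13)): `exists_splitPlaceFrame₃` (the formula frame)
import Literature.NumberTheory.Weil1965.ThetaIntegralNullFibre   -- ★ p811176 (B-p10 (g16)): `μ̂_0 = 0` under anisotropy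
import Summits.HodgeConjecture.HodgeConjecture.Theorems.H413E2SWHNormAnisotropic   -- ★ p809129 (A-p18 (g17)): `hNorm (ratPt ξ) = 0 ↔ ξ = 0`
import HarnessLib

/-!
# H413 · E-2 · SW2 (iii) — I-CLOSE: the TRIPLES for every `b` ON THE FORMULA FRAME (β-parametric, and with `hβv` exported)

Cell `hodgecm-mathlib`, crux H413 (`stmt-HodgeConjecture-24833`), child line `Cruxes/H413/Lines/F0_E2SiegelWeilWeilRange.lean`, stub
`stub_SW2iii_siegelWeil`, identity half; F0P4-plan (g4) 2026-08-31 05:19:54Z (1) (p01 (g3)'s integration flag on ★ p811637: its `βv` is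
opaque, while (δ) ★ `twistLM_torus_apply` and the (S-1) riders need the FORMULA frame of ★ `exists_splitPlaceFrame₃`).  PROOF lane,
`--supports stmt-HodgeConjecture-24833 --as helper`.  KERNEL MATHEMATICS ONLY (theorems; no definition, no named fact, no `sorry`).
HC_CM is proved only modulo the 7 printed citations until rung 0 closes; nothing here is about Hodge classes.

* `frame_identityClose_triples_all_of_frame` — ★ p811637's theorem made β-PARAMETRIC: for a GIVEN frame `β` (pairing identity, Haar
  clause, realisation clause) and GIVEN the two (S-3E) nulls at `β`, the frame `βv = β`, `fr = (β × id) ∘ placeSplitting⁻¹` and the (T1)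
  triples `H₁ b`, `H₂ b` for every `b` (theta `b = 0` by ★ `μ̂_0 = 0` + anisotropy; Eisenstein `b = 0` by the `b`-free finiteness ∕
  invariance and the carrier split; `b ≠ 0` by the ★ producers of ★ p811251).
* `exists_frame_identityClose_triples_all₃` — the packaged form over ★ `exists_splitPlaceFrame₃`: ★ p811637's conclusion ⊕ the formula
  conjunct `hβv`, obtain shape `⟨βv, fr, he1, he2, -, H₁, H₂, hβv⟩`.

References: A. Weil, *Sur la formule de Siegel dans la théorie des groupes classiques*, Acta Math. 113 (1965), Chap. IV n° 41 (35)
p. 59; Chap. V n° 46 p. 66, n° 50 pp. 73–74; Chap. VI n° 51 p. 75 [Weil1965].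
-/

set_option autoImplicit false
-- the cell's `Summit.HodgeConjecture.HodgeConjecture.…` namespace repeats the summit name by design (D-0017 layout)
set_option linter.dupNamespace false

noncomputable section

open MeasureTheory NumberField Filter Topology Set IsDedekindDomain
open scoped NNReal Matrix ENNReal RestrictedProduct ComplexOrder
open Literature.NumberTheory.Automorphic Literature.NumberTheory.Weil1964 Literature.NumberTheory.Weil1965
open Literature.NumberTheory.Weil1965.UnitaryDoubling
open Literature.NumberTheory.GelbartRogawski1991 Literature.NumberTheory.GelbartRogawski1991.UnitaryDualPair
open Literature.RepresentationTheory.HeisenbergGroup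
open Literature.NumberTheory.GaloisRepresentations.IsNonarchimedeanLocalField
open Literature.NumberTheory.Automorphic.AdelicVector (evalAt trivialAt placeSplitting)
open Summit.HodgeConjecture.HodgeConjecture.Cruxes.H413.E2SWSplitPlaceFrame
open Summit.HodgeConjecture.HodgeConjecture.Cruxes.H413.E2SWSplitPlaceLetters
open Summit.HodgeConjecture.HodgeConjecture.Cruxes.H413

namespace Summit.HodgeConjecture.HodgeConjecture.Cruxes.H413.E2SWIdentityCloseTriplesAllFormulaCM

/-- a linear equivalence from `K^m` onto `K^p × K^q` has a continuous inverse (all linear maps out of `K^p`, `K^q` are continuous).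
[folklore] -/
private theorem continuous_linearEquiv_symm_prod {K : Type} [Field K] [TopologicalSpace K] [IsTopologicalRing K] {m p q : ℕ}
    (β : (Fin m → K) ≃ₗ[K] ((Fin p → K) × (Fin q → K))) : Continuous β.symm := by
  haveI : ContinuousSMul K K := ⟨continuous_mul⟩
  have h1 : Continuous fun a : Fin p → K => β.symm.toLinearMap (LinearMap.inl K _ _ a) :=
    (β.symm.toLinearMap.comp (LinearMap.inl K _ _)).continuous_on_pi
  have h2 : Continuous fun b : Fin q → K => β.symm.toLinearMap (LinearMap.inr K _ _ b) :=
    (β.symm.toLinearMap.comp (LinearMap.inr K _ _)).continuous_on_pi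
  have heq : (fun z : (Fin p → K) × (Fin q → K) => β.symm z) =
      fun z => β.symm.toLinearMap (LinearMap.inl K _ _ z.1) + β.symm.toLinearMap (LinearMap.inr K _ _ z.2) := by
    funext z
    rw [← map_add, LinearMap.inl_apply, LinearMap.inr_apply, Prod.mk_add_mk, add_zero, zero_add]
    rfl
  have hc : Continuous fun z : (Fin p → K) × (Fin q → K) => β.symm z := by
    rw [heq]
    exact (h1.comp continuous_fst).add (h2.comp continuous_snd)
  exact hc

/-- `𝔸_F = F_∞ × 𝔸_F^∞` is Hausdorff (Mathlib instances on the two factors). [folklore] -/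
private theorem t2Space_adeleRing' (K : Type*) [Field K] [NumberField K] : T2Space (AdeleRing (𝓞 K) K) := by
  haveI : T2Space (FiniteAdeleRing (𝓞 K) K) := inferInstanceAs <| T2Space
    (Πʳ w : HeightOneSpectrum (𝓞 K), [w.adicCompletion K, w.adicCompletionIntegers K])
  haveI : T2Space (InfiniteAdeleRing K) :=
    inferInstanceAs <| T2Space ((w : InfinitePlace K) → w.Completion)
  exact inferInstanceAs <| T2Space (InfiniteAdeleRing K × FiniteAdeleRing (𝓞 K) K)

/-- if `x ⬝ᵥ y ≠ 0` then `x ≠ 0` and `y ≠ 0`. [folklore] -/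
private theorem ne_zero_of_dotProduct_ne_zero {K : Type*} [NonUnitalNonAssocSemiring K] {κ : Type*} [Fintype κ]
    {x y : κ → K} (h : x ⬝ᵥ y ≠ 0) : x ≠ 0 ∧ y ≠ 0 := by
  constructor
  · rintro rfl; exact h (zero_dotProduct y)
  · rintro rfl; exact h (dotProduct_zero x)

variable (F E : Type) [Field F] [NumberField F] [Field E] [NumberField E] [Algebra F E] [Algebra.IsQuadraticExtension F E]
  (c : E ≃ₐ[F] E) {δ : E} (hcδ : c δ = -δ) (hδ : δ ≠ 0) {d : F} (hd : δ * δ = algebraMap F E d)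
  (N : ℕ) {n : ℕ} (e : Fin N × Fin 1 ≃ Fin n)
  (TV : Matrix (Fin N) (Fin N) F) (hV : TV.IsSymm) (hVd : IsUnit TV.det)
  (TW : Matrix (Fin 1) (Fin 1) F) (hW : TW.IsSymm) (hWd : IsUnit TW.det)
  [LocallyCompactSpace (UnitaryGroup.adelic F E c N (TV.map (algebraMap F E)))]
  [CompactSpace (UnitaryGroup.adelic F E c N (TV.map (algebraMap F E)) ⧸ (UnitaryGroup.toAdelic F E c N (TV.map (algebraMap F E))).range)]
  [MeasurableSpace (UnitaryGroup.adelic F E c N (TV.map (algebraMap F E)) ⧸ (UnitaryGroup.toAdelic F E c N (TV.map (algebraMap F E))).range)]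
  [BorelSpace (UnitaryGroup.adelic F E c N (TV.map (algebraMap F E)) ⧸ (UnitaryGroup.toAdelic F E c N (TV.map (algebraMap F E))).range)]
  (ν : Measure (UnitaryGroup.adelic F E c N (TV.map (algebraMap F E)) ⧸ (UnitaryGroup.toAdelic F E c N (TV.map (algebraMap F E))).range))
  [IsFiniteMeasure ν]
  [SMulInvariantMeasure (UnitaryGroup.adelic F E c N (TV.map (algebraMap F E)))
    (UnitaryGroup.adelic F E c N (TV.map (algebraMap F E)) ⧸ (UnitaryGroup.toAdelic F E c N (TV.map (algebraMap F E))).range) ν]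
  [MeasurableSpace (adeleQuotient F)] [BorelSpace (adeleQuotient F)]
  [MeasurableSpace (AdeleRing (𝓞 F) F)] [BorelSpace (AdeleRing (𝓞 F) F)]
  (νX : Measure (Fin (n + n) → AdeleRing (𝓞 F) F)) [νX.IsAddHaarMeasure]
  (h : (Fin (n + n) → AdeleRing (𝓞 F) F) → AdeleRing (𝓞 F) F) (hh : Continuous h)
  (v : HeightOneSpectrum (𝓞 F))
  [MeasurableSpace (v.adicCompletion F)] [BorelSpace (v.adicCompletion F)]
  (μK : Measure (v.adicCompletion F)) [μK.IsAddHaarMeasure]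

omit [μK.IsAddHaarMeasure] in
include hδ μK in
/-- **THE (T2a)-TRIPLES FOR EVERY FIBRE `b`, ON A GIVEN SPLIT-PLACE FRAME `β`** (β-parametric form of ★ p811637
`E2SWIdentityCloseTriplesAllCM.exists_frame_identityClose_triples_all`): for a linear frame `β` of `X□(𝔸)_v` with the pairing identity `hQ`,
the Haar clause and the `v`-supported realisation of `(P, P⁻ᵀ)` (the clauses of ★ `exists_splitPlaceFrame` ∕ `₂` ∕ `₃` VERBATIM), at the CM
datum (`[IsTotallyReal F] [IsTotallyComplex E]`, `J_V` positive definite at `τ`) and GIVEN the two (S-3E) nulls AT `β` (`hE0`: `E_X` does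
not charge the coordinate hyperplanes `{(β x_v).1 = 0}`, `{(β x_v).2 = 0}` — A-p08 (g18)'s theorem), there are `βv` (= `β` as a
homeomorphism, `βv y = β y`) and `fr = (β × id) ∘ placeSplitting⁻¹` with `he1`, `he2`, the Haar clause and the triples `H₁ b`, `H₂ b` of (T1)
★ `doubledThetaIntegral_eq_mul_eis_of_frame` for EVERY `b` (`b′ b := (b : F_v)`).  Same proof as ★ p811637 with the letters taken from ★
`exists_splitPlaceLetters_of_frame` at the given `β`.
[cite: Weil1965, Chap. IV n° 41 (35) p. 59; Chap. V n° 46 p. 66, n° 50 pp. 73–74; Chap. VI n° 51 p. 75] -/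
theorem frame_identityClose_triples_all_of_frame
    (hhN : ∀ x, h x = hNorm F E c hcδ hδ N e TV hVd TW hWd x)
    (hB : ∀ Φ ∈ piSchwartzBruhat F (Fin (n + n)), Summable fun ξ : F => ‖adelicSiegelCoeff F (Fin (n + n)) νX h Φ ξ‖)
    [IsTotallyReal F] [IsTotallyComplex E] (τ : E →+* ℂ) (hτ : ((TV.map (algebraMap F E)).map τ).PosDef)
    (β : (Fin (n + n) → v.adicCompletion F) ≃ₗ[v.adicCompletion F] ((Fin n → v.adicCompletion F) × (Fin n → v.adicCompletion F)))
    (hQ : ∀ x : Fin (n + n) → AdeleRing (𝓞 F) F,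
      AdelicGroupData.adeleEval F v (hNorm F E c hcδ hδ N e TV hVd TW hWd x) =
        (β (evalAt F (Fin (n + n)) v x)).1 ⬝ᵥ (β (evalAt F (Fin (n + n)) v x)).2)
    (hHaar : ∃ cst : ℝ≥0, 0 < cst ∧
        Measure.map β (Measure.pi fun _ : Fin (n + n) => μK) =
          (cst : ℝ≥0∞) • ((Measure.pi fun _ : Fin n => μK).prod (Measure.pi fun _ : Fin n => μK)))
    (hreal : ∀ P : GL (Fin n) (v.adicCompletion F), ∃ hU : UnitaryGroup.adelic F E c N (TV.map (algebraMap F E)),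
        (∀ y ∈ trivialAt F (Fin (n + n)) v, vDiagAct F E c hcδ hδ hd N e TV hV hVd TW hW hWd hU y = y) ∧
        (∀ x : Fin (n + n) → AdeleRing (𝓞 F) F,
          β (evalAt F (Fin (n + n)) v (vDiagAct F E c hcδ hδ hd N e TV hV hVd TW hW hWd hU x)) =
            ((P : Matrix (Fin n) (Fin n) (v.adicCompletion F)) *ᵥ (β (evalAt F (Fin (n + n)) v x)).1,
              ((P⁻¹ : GL (Fin n) (v.adicCompletion F)) : Matrix (Fin n) (Fin n) (v.adicCompletion F))ᵀ *ᵥ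
                (β (evalAt F (Fin (n + n)) v x)).2)) ∧
        (∀ x : Fin (n + n) → AdeleRing (𝓞 F) F,
          ((placeSplitting F (Fin (n + n)) v).symm (vDiagAct F E c hcδ hδ hd N e TV hV hVd TW hW hWd hU x)).2 =
            ((placeSplitting F (Fin (n + n)) v).symm x).2))
    (hE0 : adelicSiegelMeasure F (Fin (n + n)) νX h hh hB {x | (β (evalAt F (Fin (n + n)) v x)).1 = 0} = 0 ∧
        adelicSiegelMeasure F (Fin (n + n)) νX h hh hB {x | (β (evalAt F (Fin (n + n)) v x)).2 = 0} = 0) :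
    ∃ (βv : (Fin (n + n) → v.adicCompletion F) ≃ₜ ((Fin n → v.adicCompletion F) × (Fin n → v.adicCompletion F)))
      (fr : (Fin (n + n) → AdeleRing (𝓞 F) F) ≃ₜ
        (((Fin n → v.adicCompletion F) × (Fin n → v.adicCompletion F)) × trivialAt F (Fin (n + n)) v)),
      (∀ y, βv y = β y) ∧
      (∀ x, (fr x).1 = βv (evalAt F (Fin (n + n)) v x)) ∧
      (∀ x, (fr x).2 = ((placeSplitting F (Fin (n + n)) v).symm x).2) ∧
      (∃ cst : ℝ≥0, 0 < cst ∧
        Measure.map βv (Measure.pi fun _ : Fin (n + n) => μK) =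
          (cst : ℝ≥0∞) • ((Measure.pi fun _ : Fin n => μK).prod (Measure.pi fun _ : Fin n => μK))) ∧
      (∀ b : F,
        (∀ (L : Set ((Fin n → v.adicCompletion F) × (Fin n → v.adicCompletion F))) (B : Set (trivialAt F (Fin (n + n)) v)),
            IsCompact L → IsCompact B →
          ((fibreMeasure F (Fin (n + n)) (thetaOrbitFunctionalReal F E c hcδ hδ hd N e TV hV hVd TW hW hWd ν)
            (thetaOrbitFunctionalReal_nonneg F E c hcδ hδ hd N e TV hV hVd TW hW hWd ν) h b).map fr) (L ×ˢ B) < ⊤) ∧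
        (∀ (g : GL (Fin n) (v.adicCompletion F)) (A : Set ((Fin n → v.adicCompletion F) × (Fin n → v.adicCompletion F)))
            (B : Set (trivialAt F (Fin (n + n)) v)), MeasurableSet A → MeasurableSet B →
          ((fibreMeasure F (Fin (n + n)) (thetaOrbitFunctionalReal F E c hcδ hδ hd N e TV hV hVd TW hW hWd ν)
            (thetaOrbitFunctionalReal_nonneg F E c hcδ hδ hd N e TV hV hVd TW hW hWd ν) h b).map fr)
            (((fun z => (((g : Matrix (Fin n) (Fin n) (v.adicCompletion F)) *ᵥ z.1,
                ((g⁻¹ : GL (Fin n) (v.adicCompletion F)) : Matrix (Fin n) (Fin n) (v.adicCompletion F))ᵀ *ᵥ z.2) :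
                  (Fin n → v.adicCompletion F) × (Fin n → v.adicCompletion F))) ⁻¹' A) ×ˢ B) =
          ((fibreMeasure F (Fin (n + n)) (thetaOrbitFunctionalReal F E c hcδ hδ hd N e TV hV hVd TW hW hWd ν)
            (thetaOrbitFunctionalReal_nonneg F E c hcδ hδ hd N e TV hV hVd TW hW hWd ν) h b).map fr) (A ×ˢ B)) ∧
        ((fibreMeasure F (Fin (n + n)) (thetaOrbitFunctionalReal F E c hcδ hδ hd N e TV hV hVd TW hW hWd ν)
            (thetaOrbitFunctionalReal_nonneg F E c hcδ hδ hd N e TV hV hVd TW hW hWd ν) h b).map fr)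
          ({z : (Fin n → v.adicCompletion F) × (Fin n → v.adicCompletion F) |
              z.1 ⬝ᵥ z.2 = (b : v.adicCompletion F) ∧ z.1 ≠ 0 ∧ z.2 ≠ 0}ᶜ ×ˢ (univ : Set (trivialAt F (Fin (n + n)) v))) = 0) ∧
      (∀ b : F,
        (∀ (L : Set ((Fin n → v.adicCompletion F) × (Fin n → v.adicCompletion F))) (B : Set (trivialAt F (Fin (n + n)) v)),
            IsCompact L → IsCompact B →
          ((adelicSiegelFibreMeasure F (Fin (n + n)) νX h hh hB b).map fr) (L ×ˢ B) < ⊤) ∧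
        (∀ (g : GL (Fin n) (v.adicCompletion F)) (A : Set ((Fin n → v.adicCompletion F) × (Fin n → v.adicCompletion F)))
            (B : Set (trivialAt F (Fin (n + n)) v)), MeasurableSet A → MeasurableSet B →
          ((adelicSiegelFibreMeasure F (Fin (n + n)) νX h hh hB b).map fr)
            (((fun z => (((g : Matrix (Fin n) (Fin n) (v.adicCompletion F)) *ᵥ z.1,
                ((g⁻¹ : GL (Fin n) (v.adicCompletion F)) : Matrix (Fin n) (Fin n) (v.adicCompletion F))ᵀ *ᵥ z.2) :
                  (Fin n → v.adicCompletion F) × (Fin n → v.adicCompletion F))) ⁻¹' A) ×ˢ B) =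
          ((adelicSiegelFibreMeasure F (Fin (n + n)) νX h hh hB b).map fr) (A ×ˢ B)) ∧
        ((adelicSiegelFibreMeasure F (Fin (n + n)) νX h hh hB b).map fr)
          ({z : (Fin n → v.adicCompletion F) × (Fin n → v.adicCompletion F) |
              z.1 ⬝ᵥ z.2 = (b : v.adicCompletion F) ∧ z.1 ≠ 0 ∧ z.2 ≠ 0}ᶜ ×ˢ (univ : Set (trivialAt F (Fin (n + n)) v))) = 0) := by
  -- the E-side norm letter IS `hNorm`
  obtain rfl : h = hNorm F E c hcδ hδ N e TV hVd TW hWd := funext hhN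
  haveI : T2Space (AdeleRing (𝓞 F) F) := t2Space_adeleRing' F
  haveI : T2Space (trivialAt F (Fin (n + n)) v) := inferInstance
  haveI := secondCountableTopology_adeleRing (K := F)
  haveI : BorelSpace (Fin (n + n) → AdeleRing (𝓞 F) F) := Pi.borelSpace
  haveI := AdelicVector.secondCountableTopology_trivialAt (K := F) (ι := Fin (n + n)) (v := v)
  haveI : BorelSpace (trivialAt F (Fin (n + n)) v) := Subtype.borelSpace _
  haveI : SecondCountableTopology (v.adicCompletion F) := secondCountableTopology_localField _
  haveI : BorelSpace (Fin n → v.adicCompletion F) := Pi.borelSpace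
  haveI : BorelSpace ((Fin n → v.adicCompletion F) × (Fin n → v.adicCompletion F)) := Prod.borelSpace
  haveI : BorelSpace (((Fin n → v.adicCompletion F) × (Fin n → v.adicCompletion F)) × trivialAt F (Fin (n + n)) v) :=
    Prod.borelSpace
  -- the letters rebuilt from the GIVEN `β` (★ `exists_splitPlaceLetters_of_frame`)
  obtain ⟨eH, T, heH, hfib0, hT, hTh, hTS, hTe⟩ :=
    E2SWSplitPlaceLettersOfFrame.exists_splitPlaceLetters_of_frame F E c hcδ hδ hd N e TV hV hVd TW hW hWd v β hQ hreal
  choose sel hsel using hT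
  haveI : ContinuousSMul (v.adicCompletion F) (v.adicCompletion F) := ⟨continuous_mul⟩
  let βH : (Fin (n + n) → v.adicCompletion F) ≃ₜ ((Fin n → v.adicCompletion F) × (Fin n → v.adicCompletion F)) :=
    { toEquiv := β.toEquiv
      continuous_toFun := β.toLinearMap.continuous_on_pi
      continuous_invFun := continuous_linearEquiv_symm_prod β }
  -- (S-3E) at this frame
  obtain ⟨hE1, hE2⟩ := hE0
  -- anisotropy at the CM datum ⇒ `μ̂_0 = 0`
  have hanis : ∀ ξ : Fin (n + n) → F, ξ ≠ 0 → hNorm F E c hcδ hδ N e TV hVd TW hWd (ratPt F (Fin (n + n)) ξ) ≠ 0 :=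
    fun ξ hξ h0 => hξ ((E2SWHNormAnisotropic.hNorm_ratPt_eq_zero_iff F E c hcδ hδ hd N e TV hV hVd TW hW hWd τ hτ ξ).mp h0)
  have hμ0 : fibreMeasure F (Fin (n + n)) (thetaOrbitFunctionalReal F E c hcδ hδ hd N e TV hV hVd TW hW hWd ν)
      (thetaOrbitFunctionalReal_nonneg F E c hcδ hδ hd N e TV hV hVd TW hW hWd ν) (hNorm F E c hcδ hδ N e TV hVd TW hWd) 0 = 0 :=
    fibreMeasure_thetaOrbitFunctionalReal_zero F E c hcδ hδ hd N e TV hV hVd TW hW hWd ν hanis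
  -- `hfib` with the non-vanishing clauses, for `b ≠ 0`
  have hfib : ∀ b : F, b ≠ 0 → ∀ x, hNorm F E c hcδ hδ N e TV hVd TW hWd x = algebraMap F (AdeleRing (𝓞 F) F) b →
      (eH x).1.1 ⬝ᵥ (eH x).1.2 = (b : v.adicCompletion F) ∧ (eH x).1.1 ≠ 0 ∧ (eH x).1.2 ≠ 0 := by
    intro b hb x hxb
    have h1 := hfib0 x b hxb
    have hb' : ((b : v.adicCompletion F)) ≠ 0 := by
      rw [ne_eq, ← map_zero (algebraMap F (v.adicCompletion F))]
      exact fun h0 => hb ((algebraMap F (v.adicCompletion F)).injective h0)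
    exact ⟨h1, ne_zero_of_dotProduct_ne_zero (h1 ▸ hb')⟩
  -- `hTe` in selector form (theta side) and `hTμ` (Eisenstein side)
  have hTe' : ∀ g x, eH (vDiagAct F E c hcδ hδ hd N e TV hV hVd TW hW hWd (sel g) x) =
      ((((g : Matrix (Fin n) (Fin n) (v.adicCompletion F)) *ᵥ (eH x).1.1,
          ((g⁻¹ : GL (Fin n) (v.adicCompletion F)) : Matrix (Fin n) (Fin n) (v.adicCompletion F))ᵀ *ᵥ (eH x).1.2) :
            (Fin n → v.adicCompletion F) × (Fin n → v.adicCompletion F)), (eH x).2) := fun g x => by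
    rw [← hTe g x, hsel g]
  have hTμ : ∀ g, MeasurePreserving (T g) νX νX := fun g => by
    have h1 := measurePreserving_vDiagAct F E c hcδ hδ hd N e TV hV hVd TW hW hWd νX (sel g)
    have h2 : (⇑(T g) : (Fin (n + n) → AdeleRing (𝓞 F) F) → (Fin (n + n) → AdeleRing (𝓞 F) F)) =
        ⇑(vDiagAct F E c hcδ hδ hd N e TV hV hVd TW hW hWd (sel g)) := hsel g
    rw [h2]; exact h1
  have hem : Measurable eH := eH.continuous.measurable
  refine ⟨βH, eH, fun y => rfl, fun x => by rw [heH]; rfl, fun x => by rw [heH], hHaar, fun b => ?_, fun b => ?_⟩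
  · -- `H₁ b`: the theta side
    by_cases hb : b = 0
    · -- `b = 0`: `μ̂_0 = 0`
      subst hb
      have hz : (fibreMeasure F (Fin (n + n)) (thetaOrbitFunctionalReal F E c hcδ hδ hd N e TV hV hVd TW hW hWd ν)
          (thetaOrbitFunctionalReal_nonneg F E c hcδ hδ hd N e TV hV hVd TW hW hWd ν) (hNorm F E c hcδ hδ N e TV hVd TW hWd) 0).map eH = 0 := by
        rw [hμ0, Measure.map_zero]
      refine ⟨fun L B _ _ => ?_, fun g A B _ _ => ?_, ?_⟩
      · rw [hz]; exact ENNReal.zero_lt_top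
      · rw [hz]; rfl
      · rw [hz]; rfl
    · exact map_fibreMeasure_thetaOrbitFunctionalReal_identityClose_hypotheses F E c hcδ hδ hd N e TV hV hVd TW hW hWd ν eH b
        (b : v.adicCompletion F) (hfib b hb) sel hTe'
  · -- `H₂ b`: the Eisenstein side
    by_cases hb : b = 0
    · subst hb
      refine ⟨fun L B hL hBc => ?_, fun g A B hA hBm => ?_, ?_⟩
      · -- finiteness on compact rectangles (`b`-free)
        exact map_fibreMeasure_prod_lt_top F (Fin (n + n)) _ _ (hNorm F E c hcδ hδ N e TV hVd TW hWd) eH (0 : F) hL hBc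
      · -- invariance on Borel rectangles (`b`-free)
        set G : (Fin n → v.adicCompletion F) × (Fin n → v.adicCompletion F) →
            (Fin n → v.adicCompletion F) × (Fin n → v.adicCompletion F) := fun z =>
          (((g : Matrix (Fin n) (Fin n) (v.adicCompletion F)) *ᵥ z.1,
            ((g⁻¹ : GL (Fin n) (v.adicCompletion F)) : Matrix (Fin n) (Fin n) (v.adicCompletion F))ᵀ *ᵥ z.2) :
              (Fin n → v.adicCompletion F) × (Fin n → v.adicCompletion F)) with hG
        set GG : ((Fin n → v.adicCompletion F) × (Fin n → v.adicCompletion F)) × trivialAt F (Fin (n + n)) v →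
            ((Fin n → v.adicCompletion F) × (Fin n → v.adicCompletion F)) × trivialAt F (Fin (n + n)) v :=
          fun z => (G z.1, z.2) with hGG
        have hGm : Measurable G :=
          ((continuous_const.matrix_mulVec continuous_fst).prodMk (continuous_const.matrix_mulVec continuous_snd)).measurable
        have hGGm : Measurable GG := (hGm.comp measurable_fst).prodMk measurable_snd
        have hpre : (G ⁻¹' A) ×ˢ B = GG ⁻¹' (A ×ˢ B) := by
          ext z; simp only [mem_prod, mem_preimage, hGG]
        have hGGν : ((adelicSiegelFibreMeasure F (Fin (n + n)) νX (hNorm F E c hcδ hδ N e TV hVd TW hWd) hh hB 0).map eH).map GG =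
            (adelicSiegelFibreMeasure F (Fin (n + n)) νX (hNorm F E c hcδ hδ N e TV hVd TW hWd) hh hB 0).map eH := by
          simpa only [hGG, hG] using
            map_splitAct_map_adelicSiegelFibreMeasure_eq F (Fin (n + n)) νX (hNorm F E c hcδ hδ N e TV hVd TW hWd) hh hB eH (0 : F)
              T hTμ hTh hTS hTe g
        rw [hpre, ← Measure.map_apply hGGm (hA.prod hBm), hGGν]
      · -- the carrier at `b = 0`: pairing letter + (S-3E)
        have hSm : MeasurableSet ({z : (Fin n → v.adicCompletion F) × (Fin n → v.adicCompletion F) |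
            z.1 ⬝ᵥ z.2 = ((0 : F) : v.adicCompletion F) ∧ z.1 ≠ 0 ∧ z.2 ≠ 0}ᶜ ×ˢ (univ : Set (trivialAt F (Fin (n + n)) v))) := by
          refine MeasurableSet.prod (MeasurableSet.compl ?_) MeasurableSet.univ
          have h1 : MeasurableSet {z : (Fin n → v.adicCompletion F) × (Fin n → v.adicCompletion F) |
              z.1 ⬝ᵥ z.2 = ((0 : F) : v.adicCompletion F)} :=
            (isClosed_eq (continuous_fst.dotProduct continuous_snd) continuous_const).measurableSet
          have h2 : MeasurableSet {z : (Fin n → v.adicCompletion F) × (Fin n → v.adicCompletion F) | z.1 ≠ 0} :=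
            (isClosed_eq continuous_fst continuous_const).measurableSet.compl
          have h3 : MeasurableSet {z : (Fin n → v.adicCompletion F) × (Fin n → v.adicCompletion F) | z.2 ≠ 0} :=
            (isClosed_eq continuous_snd continuous_const).measurableSet.compl
          simpa only [setOf_and] using h1.inter (h2.inter h3)
        rw [Measure.map_apply hem hSm]
        have hsub : eH ⁻¹' ({z : (Fin n → v.adicCompletion F) × (Fin n → v.adicCompletion F) |
              z.1 ⬝ᵥ z.2 = ((0 : F) : v.adicCompletion F) ∧ z.1 ≠ 0 ∧ z.2 ≠ 0}ᶜ ×ˢ (univ : Set (trivialAt F (Fin (n + n)) v))) ⊆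
            ((hNorm F E c hcδ hδ N e TV hVd TW hWd) ⁻¹' {algebraMap F (AdeleRing (𝓞 F) F) 0})ᶜ ∪
              ({x | (β (evalAt F (Fin (n + n)) v x)).1 = 0} ∪ {x | (β (evalAt F (Fin (n + n)) v x)).2 = 0}) := by
          intro x hx
          simp only [mem_preimage, mem_prod, mem_univ, and_true, mem_compl_iff, mem_setOf_eq] at hx
          by_cases hxb : hNorm F E c hcδ hδ N e TV hVd TW hWd x = algebraMap F (AdeleRing (𝓞 F) F) 0
          · have hpair := hfib0 x 0 hxb
            have h12 : (eH x).1 = β (evalAt F (Fin (n + n)) v x) := by rw [heH]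
            right
            by_contra hcon
            simp only [mem_union, mem_setOf_eq, not_or] at hcon
            rw [← h12] at hcon
            exact hx ⟨hpair, hcon.1, hcon.2⟩
          · left
            exact hxb
        refine measure_mono_null hsub (measure_union_null ?_ (measure_union_null ?_ ?_))
        · exact fibreMeasure_compl F (Fin (n + n)) _ _ (hNorm F E c hcδ hδ N e TV hVd TW hWd)
            (continuous_hNorm F E c hcδ hδ N e TV hVd TW hWd) 0
        · exact le_antisymm ((Measure.le_iff'.1 (fibreMeasure_le F (Fin (n + n)) _ _ (hNorm F E c hcδ hδ N e TV hVd TW hWd) 0) _).trans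
            hE1.le) bot_le
        · exact le_antisymm ((Measure.le_iff'.1 (fibreMeasure_le F (Fin (n + n)) _ _ (hNorm F E c hcδ hδ N e TV hVd TW hWd) 0) _).trans
            hE2.le) bot_le
    · exact map_adelicSiegelFibreMeasure_identityClose_hypotheses F (Fin (n + n)) νX _ hh hB eH b (b : v.adicCompletion F)
        (hfib b hb) T hTμ hTh hTS hTe


include hδ μK in
/-- **THE FRAME WITH ITS FORMULA, AND THE TRIPLES FOR EVERY `b`** — ★ p811637 `exists_frame_identityClose_triples_all` ⊕ the LAST conjunct
`hβv : βv y = (y¹ + s • 𝕋_v⁻¹ y², 𝕋_v y¹ − s • y²)` (`𝕋 = gram`, `y¹ = y ∘ Fin.castAdd n`, `y² = y ∘ Fin.natAdd n`), the formula of ★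
`E2SWSplitPlaceFrame.exists_splitPlaceFrame₃` (A-p01 (g13), p811655) — so that the (S-1) glue can read ★ `twistLM_torus_apply` and the other
torus riders on the SAME `βv` (F0P4-plan (g4) 2026-08-31 05:19:54Z (1), p01 (g3)'s integration flag).  Obtain shape for `hfib_CM` ∕ `hLD_CM`:
`⟨βv, fr, he1, he2, -, H₁, H₂, hβv⟩`.  Hypotheses as in ★ p811637 (`hS3E` = A-p08 (g18)'s (S-3E) CM corollary shape).
[cite: Weil1965, Chap. IV n° 41 (35) p. 59; Chap. V n° 46 p. 66, n° 50 pp. 73–74; Chap. VI n° 51 p. 75] -/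
theorem exists_frame_identityClose_triples_all₃
    (hhN : ∀ x, h x = hNorm F E c hcδ hδ N e TV hVd TW hWd x)
    (hB : ∀ Φ ∈ piSchwartzBruhat F (Fin (n + n)), Summable fun ξ : F => ‖adelicSiegelCoeff F (Fin (n + n)) νX h Φ ξ‖)
    {s : v.adicCompletion F} (hs : s * s = algebraMap F (v.adicCompletion F) d)
    [IsTotallyReal F] [IsTotallyComplex E] (τ : E →+* ℂ) (hτ : ((TV.map (algebraMap F E)).map τ).PosDef)
    (hS3E : ∀ β : (Fin (n + n) → v.adicCompletion F) ≃ₗ[v.adicCompletion F]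
        ((Fin n → v.adicCompletion F) × (Fin n → v.adicCompletion F)),
      (∀ x : Fin (n + n) → AdeleRing (𝓞 F) F,
        AdelicGroupData.adeleEval F v (hNorm F E c hcδ hδ N e TV hVd TW hWd x) =
          (β (evalAt F (Fin (n + n)) v x)).1 ⬝ᵥ (β (evalAt F (Fin (n + n)) v x)).2) →
      (∃ cst : ℝ≥0, 0 < cst ∧
        Measure.map β (Measure.pi fun _ : Fin (n + n) => μK) =
          (cst : ℝ≥0∞) • ((Measure.pi fun _ : Fin n => μK).prod (Measure.pi fun _ : Fin n => μK))) →
      adelicSiegelMeasure F (Fin (n + n)) νX h hh hB {x | (β (evalAt F (Fin (n + n)) v x)).1 = 0} = 0 ∧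
        adelicSiegelMeasure F (Fin (n + n)) νX h hh hB {x | (β (evalAt F (Fin (n + n)) v x)).2 = 0} = 0) :
    ∃ (βv : (Fin (n + n) → v.adicCompletion F) ≃ₜ ((Fin n → v.adicCompletion F) × (Fin n → v.adicCompletion F)))
      (fr : (Fin (n + n) → AdeleRing (𝓞 F) F) ≃ₜ
        (((Fin n → v.adicCompletion F) × (Fin n → v.adicCompletion F)) × trivialAt F (Fin (n + n)) v)),
      (∀ x, (fr x).1 = βv (evalAt F (Fin (n + n)) v x)) ∧
      (∀ x, (fr x).2 = ((placeSplitting F (Fin (n + n)) v).symm x).2) ∧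
      (∃ cst : ℝ≥0, 0 < cst ∧
        Measure.map βv (Measure.pi fun _ : Fin (n + n) => μK) =
          (cst : ℝ≥0∞) • ((Measure.pi fun _ : Fin n => μK).prod (Measure.pi fun _ : Fin n => μK))) ∧
      (∀ b : F,
        (∀ (L : Set ((Fin n → v.adicCompletion F) × (Fin n → v.adicCompletion F))) (B : Set (trivialAt F (Fin (n + n)) v)),
            IsCompact L → IsCompact B →
          ((fibreMeasure F (Fin (n + n)) (thetaOrbitFunctionalReal F E c hcδ hδ hd N e TV hV hVd TW hW hWd ν)
            (thetaOrbitFunctionalReal_nonneg F E c hcδ hδ hd N e TV hV hVd TW hW hWd ν) h b).map fr) (L ×ˢ B) < ⊤) ∧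
        (∀ (g : GL (Fin n) (v.adicCompletion F)) (A : Set ((Fin n → v.adicCompletion F) × (Fin n → v.adicCompletion F)))
            (B : Set (trivialAt F (Fin (n + n)) v)), MeasurableSet A → MeasurableSet B →
          ((fibreMeasure F (Fin (n + n)) (thetaOrbitFunctionalReal F E c hcδ hδ hd N e TV hV hVd TW hW hWd ν)
            (thetaOrbitFunctionalReal_nonneg F E c hcδ hδ hd N e TV hV hVd TW hW hWd ν) h b).map fr)
            (((fun z => (((g : Matrix (Fin n) (Fin n) (v.adicCompletion F)) *ᵥ z.1,
                ((g⁻¹ : GL (Fin n) (v.adicCompletion F)) : Matrix (Fin n) (Fin n) (v.adicCompletion F))ᵀ *ᵥ z.2) :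
                  (Fin n → v.adicCompletion F) × (Fin n → v.adicCompletion F))) ⁻¹' A) ×ˢ B) =
          ((fibreMeasure F (Fin (n + n)) (thetaOrbitFunctionalReal F E c hcδ hδ hd N e TV hV hVd TW hW hWd ν)
            (thetaOrbitFunctionalReal_nonneg F E c hcδ hδ hd N e TV hV hVd TW hW hWd ν) h b).map fr) (A ×ˢ B)) ∧
        ((fibreMeasure F (Fin (n + n)) (thetaOrbitFunctionalReal F E c hcδ hδ hd N e TV hV hVd TW hW hWd ν)
            (thetaOrbitFunctionalReal_nonneg F E c hcδ hδ hd N e TV hV hVd TW hW hWd ν) h b).map fr)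
          ({z : (Fin n → v.adicCompletion F) × (Fin n → v.adicCompletion F) |
              z.1 ⬝ᵥ z.2 = (b : v.adicCompletion F) ∧ z.1 ≠ 0 ∧ z.2 ≠ 0}ᶜ ×ˢ (univ : Set (trivialAt F (Fin (n + n)) v))) = 0) ∧
      (∀ b : F,
        (∀ (L : Set ((Fin n → v.adicCompletion F) × (Fin n → v.adicCompletion F))) (B : Set (trivialAt F (Fin (n + n)) v)),
            IsCompact L → IsCompact B →
          ((adelicSiegelFibreMeasure F (Fin (n + n)) νX h hh hB b).map fr) (L ×ˢ B) < ⊤) ∧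
        (∀ (g : GL (Fin n) (v.adicCompletion F)) (A : Set ((Fin n → v.adicCompletion F) × (Fin n → v.adicCompletion F)))
            (B : Set (trivialAt F (Fin (n + n)) v)), MeasurableSet A → MeasurableSet B →
          ((adelicSiegelFibreMeasure F (Fin (n + n)) νX h hh hB b).map fr)
            (((fun z => (((g : Matrix (Fin n) (Fin n) (v.adicCompletion F)) *ᵥ z.1,
                ((g⁻¹ : GL (Fin n) (v.adicCompletion F)) : Matrix (Fin n) (Fin n) (v.adicCompletion F))ᵀ *ᵥ z.2) :
                  (Fin n → v.adicCompletion F) × (Fin n → v.adicCompletion F))) ⁻¹' A) ×ˢ B) =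
          ((adelicSiegelFibreMeasure F (Fin (n + n)) νX h hh hB b).map fr) (A ×ˢ B)) ∧
        ((adelicSiegelFibreMeasure F (Fin (n + n)) νX h hh hB b).map fr)
          ({z : (Fin n → v.adicCompletion F) × (Fin n → v.adicCompletion F) |
              z.1 ⬝ᵥ z.2 = (b : v.adicCompletion F) ∧ z.1 ≠ 0 ∧ z.2 ≠ 0}ᶜ ×ˢ (univ : Set (trivialAt F (Fin (n + n)) v))) = 0) ∧
      (∀ y, βv y =
        ((fun i => y (Fin.castAdd n i)) +
            s • ((UnitaryDualPair.gram F e TV TW).map (algebraMap F (v.adicCompletion F)))⁻¹ *ᵥ (fun i => y (Fin.natAdd n i)),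
          (UnitaryDualPair.gram F e TV TW).map (algebraMap F (v.adicCompletion F)) *ᵥ (fun i => y (Fin.castAdd n i)) -
            s • (fun i => y (Fin.natAdd n i)))) := by
  obtain ⟨β, hβ, hQ, hHaar, hreal, -, -⟩ := exists_splitPlaceFrame₃ F E c hcδ hδ hd N e TV hV hVd TW hW hWd v hs μK
  obtain ⟨βv, fr, hβv, he1, he2, hH, H₁, H₂⟩ := frame_identityClose_triples_all_of_frame F E c hcδ hδ hd N e TV hV hVd TW hW hWd ν νX h hh v μK
    hhN hB τ hτ β hQ hHaar hreal (hS3E β hQ hHaar)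
  exact ⟨βv, fr, he1, he2, hH, H₁, H₂, fun y => (hβv y).trans (hβ y)⟩

end Summit.HodgeConjecture.HodgeConjecture.Cruxes.H413.E2SWIdentityCloseTriplesAllFormulaCM

end
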